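import Summits.AtomisticToContinuum.FouriersLaw.Theorems.HiddenChargeMazurStaticKuboStubLasotaYorkeCoupling

/-!
# `HiddenChargeMazur.StaticKubo`, line `birth`, stub `stub_lasotaYorke` — aux 5: low-energy pairs

Helper file (`--supports stmt-AtomisticToContinuum-13510`, crux decl `HiddenChargeMazur.StaticKubo`,
skeleton `Cruxes/StaticKubo/Lines/birth.lean` rev 4, stub S5 `stub_lasotaYorke` of the lead).

The LOW-ENERGY step of the Doeblin–Fortet inequality: split `φ = φχ + φ(1 − χ)` with the energy cutoff
`χ = χ_R = max 0 (min 1 (R + 1 − H))`.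

* `cutoff_pointwise` — pointwise coupling inequality for `φ(1−χ)`: the pair constant only enters through the
  factor `1 − χ(X)`, which vanishes unless the energy at time one exceeds `R`;
* `lintegral_abs_sub_cutoff_le` — its integrated form (Cauchy–Schwarz with the event `{R < H(X_1^x)}`);
* `cutoff_forecast_pair_bound` — raw bound for `|P_1(φ(1−χ))(x) − P_1(φ(1−χ))(y)|` with the small factor
  `(e^{-θ₁R} e^{2θ₁γT} e^{θ₁Hx})^{1/4}` in front of the pair constant.

References: folklore. Nothing here closes the item.
-/

noncomputable section

open MeasureTheory Filter Topology Set Metric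
open scoped NNReal ENNReal
open Literature.MathematicalPhysics.KineticTheory.HeatConduction Literature.MathematicalPhysics.KineticTheory
open Literature.Probability.Process OscillatorChain

namespace Summit.AtomisticToContinuum.FouriersLaw.Cruxes.StaticKubo.Birth.Stubs

variable {N : ℕ}

/-- **Pointwise coupling inequality for the cut-off observable `φ(1 − χ)`** (pure real bookkeeping): with
`0 ≤ D ≤ d`, cutoff values `cX, cY ∈ [0,1]`, `|a| ≤ M vX`, `|b| ≤ M vY`, and on `D ≤ 1` the pair bound
`|a − b| ≤ K D (wX + wY)` and the cutoff bound `|cX − cY| ≤ L D`: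
`|a(1−cX) − b(1−cY)| ≤ d ((1 − cX) K (wX + wY) + M (L + 1)(vX + vY))`. [folklore] -/
theorem cutoff_pointwise :
    ∀ (a b cX cY wX wY vX vY D d K M L : ℝ), 0 ≤ K → 0 ≤ M → 0 ≤ L → 0 ≤ wX → 0 ≤ wY → 0 ≤ vX → 0 ≤ vY →
      0 ≤ D → D ≤ d → 0 ≤ cX → cX ≤ 1 → 0 ≤ cY → cY ≤ 1 →
      (D ≤ 1 → |a - b| ≤ K * D * (wX + wY)) → (D ≤ 1 → |cX - cY| ≤ L * D) → |a| ≤ M * vX → |b| ≤ M * vY →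
      |a * (1 - cX) - b * (1 - cY)| ≤ d * ((1 - cX) * (K * (wX + wY)) + M * (L + 1) * (vX + vY)) := by
  intro a b cX cY wX wY vX vY D d K M L hK hM hL hwX hwY hvX hvY hD hDd hcX0 hcX1 hcY0 hcY1 hpair hcut ha hb
  have hd : 0 ≤ d := hD.trans hDd
  have hKw : 0 ≤ K * (wX + wY) := mul_nonneg hK (add_nonneg hwX hwY)
  have hMv : 0 ≤ M * (vX + vY) := mul_nonneg hM (add_nonneg hvX hvY)
  rcases le_or_gt D 1 with h1 | h1
  · have hp := hpair h1
    have hc := hcut h1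
    have hsplit : a * (1 - cX) - b * (1 - cY) = (a - b) * (1 - cX) + b * (cY - cX) := by ring
    rw [hsplit]
    have hb0 : |b| * |cY - cX| ≤ M * vY * (L * D) := by
      rw [abs_sub_comm] at hc
      exact mul_le_mul hb hc (abs_nonneg _) (mul_nonneg hM hvY)
    calc |(a - b) * (1 - cX) + b * (cY - cX)| ≤ |(a - b) * (1 - cX)| + |b * (cY - cX)| := abs_add_le _ _
      _ = |a - b| * (1 - cX) + |b| * |cY - cX| := by rw [abs_mul, abs_mul, abs_of_nonneg (sub_nonneg.2 hcX1)]
      _ ≤ K * D * (wX + wY) * (1 - cX) + M * vY * (L * D) :=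
          add_le_add (mul_le_mul_of_nonneg_right hp (by linarith)) hb0
      _ ≤ K * d * (wX + wY) * (1 - cX) + M * vY * (L * d) := by gcongr
      _ ≤ d * ((1 - cX) * (K * (wX + wY)) + M * (L + 1) * (vX + vY)) := by
          nlinarith [mul_nonneg hM hvX, mul_nonneg hM hvY, mul_nonneg (mul_nonneg hM hvX) hL,
            mul_nonneg hd (mul_nonneg hM (add_nonneg hvX hvY))]
  · have h2 : |a * (1 - cX) - b * (1 - cY)| ≤ M * (vX + vY) := by
      calc |a * (1 - cX) - b * (1 - cY)| ≤ |a * (1 - cX)| + |b * (1 - cY)| := abs_sub _ _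
        _ = |a| * (1 - cX) + |b| * (1 - cY) := by
            rw [abs_mul, abs_mul, abs_of_nonneg (sub_nonneg.2 hcX1), abs_of_nonneg (sub_nonneg.2 hcY1)]
        _ ≤ |a| * 1 + |b| * 1 := by gcongr <;> linarith
        _ ≤ M * vX + M * vY := by linarith
        _ = M * (vX + vY) := by ring
    have h3 : M * (vX + vY) ≤ d * (M * (vX + vY)) := by nlinarith
    calc |a * (1 - cX) - b * (1 - cY)| ≤ d * (M * (vX + vY)) := h2.trans h3
      _ ≤ d * ((1 - cX) * (K * (wX + wY)) + M * (L + 1) * (vX + vY)) := by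
          nlinarith [mul_nonneg (by linarith : (0 : ℝ) ≤ 1 - cX) hKw, mul_nonneg hd (mul_nonneg hL hMv)]

section Flow

variable {ω₂ lam β γ : ℝ} (hω : 0 < ω₂) (hl : 0 ≤ lam) (hβ : 0 ≤ β) (hγ : 0 ≤ γ) (hN : 0 < N)
  {T : ℝ} (hT : 0 < T)
include hω hl hβ hγ hN hT

-- the flow is a limit of Picard iterations: never let the unifier unfold it (heartbeats)
attribute [local irreducible] OscillatorChain.chainFlow

/-- **The integrated coupling estimate for the cut-off observable.** Setting of `lintegral_abs_sub_le_of_coupling`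
at time `1`, with the cutoff `χ = max 0 (min 1 (R + 1 − H))` (`R ≥ 0`), a fourth-moment bound `E e^{4Λ} ≤ G₄`
(aux 2 with `p = 4`) and a bound `π` of the probability of the event `{R < H(X_1^x)}`:
`E|φ(1−χ)(X) − φ(1−χ)(Y)| ≤ ‖x−y‖ (K G₄^{1/4}(√B_x + √B_y) π^{1/4} + M (L_R + 1) √G (√D_x + √D_y))`,
`L_R = K_H e^{K_H}(R + 2)` the cutoff's pair constant (aux 1). [folklore] -/
theorem lintegral_abs_sub_cutoff_le {C₀ : ℝ} (hC : 0 ≤ C₀) (x y : PhaseSpace N)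
    (hD : ∀ ω : WienerPair, ‖(pinnedChain ω₂ lam β γ).solMap N T T 1 x (pairPath ω) -
        (pinnedChain ω₂ lam β γ).solMap N T T 1 y (pairPath ω)‖ ≤
      ‖x - y‖ * Real.exp (∫ s in (0 : ℝ)..1, C₀ * (1 +
        Real.sqrt ((pinnedChain ω₂ lam β γ).hamiltonian N ((pinnedChain ω₂ lam β γ).solMap N T T s x (pairPath ω))) +
        Real.sqrt ((pinnedChain ω₂ lam β γ).hamiltonian N ((pinnedChain ω₂ lam β γ).solMap N T T s y (pairPath ω))))))
    {φ : PhaseSpace N → ℝ} {Mφ Kφ ϑ θ₁ R : ℝ} (hM : 0 ≤ Mφ) (hK : 0 ≤ Kφ) (hR : 0 ≤ R)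
    (hval : ∀ z, |φ z| ≤ Mφ * Real.exp (ϑ * (pinnedChain ω₂ lam β γ).hamiltonian N z))
    (hpair : ∀ z z', ‖z - z'‖ ≤ 1 → |φ z - φ z'| ≤ Kφ * ‖z - z'‖ *
      (Real.exp (θ₁ * (pinnedChain ω₂ lam β γ).hamiltonian N z) + Real.exp (θ₁ * (pinnedChain ω₂ lam β γ).hamiltonian N z')))
    {Bx By Dx Dy π : ℝ} (hBx0 : 0 ≤ Bx) (hBy0 : 0 ≤ By) (hDx0 : 0 ≤ Dx) (hDy0 : 0 ≤ Dy) (hπ0 : 0 ≤ π)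
    (hBx : ∫⁻ ω, ENNReal.ofReal (Real.exp (2 * θ₁ * (pinnedChain ω₂ lam β γ).hamiltonian N
        ((pinnedChain ω₂ lam β γ).solMap N T T 1 x (pairPath ω)))) ∂wienerPair ≤ ENNReal.ofReal Bx)
    (hBy : ∫⁻ ω, ENNReal.ofReal (Real.exp (2 * θ₁ * (pinnedChain ω₂ lam β γ).hamiltonian N
        ((pinnedChain ω₂ lam β γ).solMap N T T 1 y (pairPath ω)))) ∂wienerPair ≤ ENNReal.ofReal By)
    (hDx : ∫⁻ ω, ENNReal.ofReal (Real.exp (2 * ϑ * (pinnedChain ω₂ lam β γ).hamiltonian N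
        ((pinnedChain ω₂ lam β γ).solMap N T T 1 x (pairPath ω)))) ∂wienerPair ≤ ENNReal.ofReal Dx)
    (hDy : ∫⁻ ω, ENNReal.ofReal (Real.exp (2 * ϑ * (pinnedChain ω₂ lam β γ).hamiltonian N
        ((pinnedChain ω₂ lam β γ).solMap N T T 1 y (pairPath ω)))) ∂wienerPair ≤ ENNReal.ofReal Dy)
    (hπ : wienerPair {ω | R < (pinnedChain ω₂ lam β γ).hamiltonian N
        ((pinnedChain ω₂ lam β γ).solMap N T T 1 x (pairPath ω))} ≤ ENNReal.ofReal π) :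
    ∫⁻ ω, ENNReal.ofReal |φ ((pinnedChain ω₂ lam β γ).solMap N T T 1 x (pairPath ω)) *
          (1 - max 0 (min 1 (R + 1 - (pinnedChain ω₂ lam β γ).hamiltonian N ((pinnedChain ω₂ lam β γ).solMap N T T 1 x (pairPath ω))))) -
        φ ((pinnedChain ω₂ lam β γ).solMap N T T 1 y (pairPath ω)) *
          (1 - max 0 (min 1 (R + 1 - (pinnedChain ω₂ lam β γ).hamiltonian N ((pinnedChain ω₂ lam β γ).solMap N T T 1 y (pairPath ω)))))|
        ∂wienerPair ≤
      ENNReal.ofReal (‖x - y‖ * (Kφ * (Real.exp (4 * C₀ + (32 * C₀ ^ 2 * T + γ) +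
          (16 * C₀ ^ 2 * T + 1 / (4 * T)) * (Real.sqrt ((pinnedChain ω₂ lam β γ).hamiltonian N x) +
            Real.sqrt ((pinnedChain ω₂ lam β γ).hamiltonian N y))) ^ (1 / 4 : ℝ) * (Real.sqrt Bx + Real.sqrt By) *
          π ^ (1 / 4 : ℝ)) +
        Mφ * (((N * (ω₂ / 2 + 3 + lam / ω₂ + N ^ 2 * (3 + β)) + N / 2 + 1) *
          Real.exp (N * (ω₂ / 2 + 3 + lam / ω₂ + N ^ 2 * (3 + β)) + N / 2 + 1) * (R + 2) + 1) *
          Real.sqrt (Real.exp (2 * C₀ + (8 * C₀ ^ 2 * T + γ) +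
            (4 * C₀ ^ 2 * T + 1 / (4 * T)) * (Real.sqrt ((pinnedChain ω₂ lam β γ).hamiltonian N x) +
              Real.sqrt ((pinnedChain ω₂ lam β γ).hamiltonian N y)))) * (Real.sqrt Dx + Real.sqrt Dy)))) := by
  set P := pinnedChain ω₂ lam β γ with hP
  set H := P.hamiltonian N with hH
  have hHm : Measurable H := (pinnedChain_continuous_hamiltonian ω₂ lam β γ N).measurable
  set X : WienerPair → PhaseSpace N := fun ω => P.solMap N T T 1 x (pairPath ω) with hX
  set Y : WienerPair → PhaseSpace N := fun ω => P.solMap N T T 1 y (pairPath ω) with hY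
  have hXm : Measurable X := pinnedChain_measurable_solMap_pairPath_right hω hl hβ hγ N T T 1 x
  have hYm : Measurable Y := pinnedChain_measurable_solMap_pairPath_right hω hl hβ hγ N T T 1 y
  set Λ : WienerPair → ℝ := fun ω => ∫ s in (0 : ℝ)..1, C₀ * (1 + Real.sqrt (H (P.solMap N T T s x (pairPath ω))) +
    Real.sqrt (H (P.solMap N T T s y (pairPath ω)))) with hΛ
  have hΛm : Measurable Λ := measurable_flowRate hω hl hβ hγ C₀ x y
  set E : WienerPair → ℝ := fun ω => Real.exp (Λ ω) with hE
  have hEm : Measurable E := Real.measurable_exp.comp hΛm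
  have hE0 : ∀ ω, 0 ≤ E ω := fun ω => (Real.exp_pos _).le
  set G : ℝ := Real.exp (2 * C₀ + (8 * C₀ ^ 2 * T + γ) + (4 * C₀ ^ 2 * T + 1 / (4 * T)) *
    (Real.sqrt (H x) + Real.sqrt (H y))) with hG
  set G₄ : ℝ := Real.exp (4 * C₀ + (32 * C₀ ^ 2 * T + γ) + (16 * C₀ ^ 2 * T + 1 / (4 * T)) *
    (Real.sqrt (H x) + Real.sqrt (H y))) with hG₄
  set L : ℝ := (N * (ω₂ / 2 + 3 + lam / ω₂ + N ^ 2 * (3 + β)) + N / 2 + 1) *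
    Real.exp (N * (ω₂ / 2 + 3 + lam / ω₂ + N ^ 2 * (3 + β)) + N / 2 + 1) * (R + 2) with hLdef
  have hL0 : 0 ≤ L := by
    have : 0 ≤ lam / ω₂ := div_nonneg hl hω.le
    positivity
  -- moments of `E`
  have hE2 : ∫⁻ ω, ENNReal.ofReal (E ω ^ 2) ∂wienerPair ≤ ENNReal.ofReal G := by
    have h := lintegral_exp_mul_flowRate_le hω hl hβ hγ hN hT hC (p := 2) two_pos x y
    have h2 : ∀ ω, E ω ^ 2 = Real.exp (2 * Λ ω) := fun ω => by
      rw [hE, ← Real.exp_nat_mul]; push_cast; ring_nf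
    simp_rw [h2]
    refine h.trans (le_of_eq ?_)
    rw [hG]; congr 2; ring
  have hE4 : ∫⁻ ω, ENNReal.ofReal (E ω ^ 4) ∂wienerPair ≤ ENNReal.ofReal G₄ := by
    have h := lintegral_exp_mul_flowRate_le hω hl hβ hγ hN hT hC (p := 4) (by norm_num) x y
    have h2 : ∀ ω, E ω ^ 4 = Real.exp (4 * Λ ω) := fun ω => by
      rw [hE, ← Real.exp_nat_mul]; push_cast; ring_nf
    simp_rw [h2]
    refine h.trans (le_of_eq ?_)
    rw [hG₄]; congr 2; ring
  -- weights and the cutoff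
  set W : PhaseSpace N → ℝ := fun z => Real.exp (θ₁ * H z) with hW
  set V : PhaseSpace N → ℝ := fun z => Real.exp (ϑ * H z) with hV
  set χ : PhaseSpace N → ℝ := fun z => max 0 (min 1 (R + 1 - H z)) with hχ
  have hWm : Measurable W := Real.measurable_exp.comp (hHm.const_mul _)
  have hVm : Measurable V := Real.measurable_exp.comp (hHm.const_mul _)
  have hχ0 : ∀ z, 0 ≤ χ z := fun z => le_max_left _ _
  have hχ1 : ∀ z, χ z ≤ 1 := fun z => max_le zero_le_one (min_le_left _ _)
  have hsq : ∀ (c : ℝ) (z : PhaseSpace N), Real.exp (c * H z) ^ 2 = Real.exp (2 * c * H z) := fun c z => by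
    rw [← Real.exp_nat_mul]; push_cast; ring_nf
  -- the event
  set S : Set WienerPair := {ω | R < H (X ω)} with hS
  have hSm : MeasurableSet S := measurableSet_lt measurable_const (hHm.comp hXm)
  have hind : ∀ ω, (1 - χ (X ω)) ≤ S.indicator (fun _ => (1 : ℝ)) ω := by
    intro ω
    by_cases hω' : ω ∈ S
    · rw [Set.indicator_of_mem hω']; linarith [hχ0 (X ω)]
    · rw [Set.indicator_of_notMem hω']
      have hle : H (X ω) ≤ R := not_lt.1 hω'
      have : χ (X ω) = 1 := by
        simp only [hχ]
        rw [min_eq_left (by linarith), max_eq_right zero_le_one]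
      rw [this]; simp
  -- pointwise inequality
  have hpt : ∀ ω, ENNReal.ofReal |φ (X ω) * (1 - χ (X ω)) - φ (Y ω) * (1 - χ (Y ω))| ≤
      ENNReal.ofReal ‖x - y‖ * (ENNReal.ofReal Kφ * (S.indicator (fun ω => ENNReal.ofReal (E ω * W (X ω))) ω +
        S.indicator (fun ω => ENNReal.ofReal (E ω * W (Y ω))) ω) +
        ENNReal.ofReal (Mφ * (L + 1)) * (ENNReal.ofReal (E ω * V (X ω)) + ENNReal.ofReal (E ω * V (Y ω)))) := by
    intro ω
    have hWX : 0 ≤ W (X ω) := (Real.exp_pos _).le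
    have hWY : 0 ≤ W (Y ω) := (Real.exp_pos _).le
    have hVX : 0 ≤ V (X ω) := (Real.exp_pos _).le
    have hVY : 0 ≤ V (Y ω) := (Real.exp_pos _).le
    have hcut : ‖X ω - Y ω‖ ≤ 1 → |χ (X ω) - χ (Y ω)| ≤ L * ‖X ω - Y ω‖ := fun h1 =>
      abs_cutoff_sub_le hω hl hβ γ N hR (X ω) (Y ω) h1
    have h := cutoff_pointwise (φ (X ω)) (φ (Y ω)) (χ (X ω)) (χ (Y ω)) (W (X ω)) (W (Y ω)) (V (X ω)) (V (Y ω))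
      ‖X ω - Y ω‖ (‖x - y‖ * E ω) Kφ Mφ L hK hM hL0 hWX hWY hVX hVY (norm_nonneg _) (hD ω)
      (hχ0 _) (hχ1 _) (hχ0 _) (hχ1 _) (fun h1 => hpair (X ω) (Y ω) h1) hcut (hval (X ω)) (hval (Y ω))
    refine (ENNReal.ofReal_le_ofReal h).trans ?_
    -- compare with the indicator form
    have hind' : ‖x - y‖ * E ω * ((1 - χ (X ω)) * (Kφ * (W (X ω) + W (Y ω))) + Mφ * (L + 1) * (V (X ω) + V (Y ω))) ≤
        ‖x - y‖ * (Kφ * (S.indicator (fun _ => (1 : ℝ)) ω * (E ω * W (X ω)) + S.indicator (fun _ => (1 : ℝ)) ω * (E ω * W (Y ω))) +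
          Mφ * (L + 1) * (E ω * V (X ω) + E ω * V (Y ω))) := by
      have hi := hind ω
      have hi0 : 0 ≤ S.indicator (fun _ => (1 : ℝ)) ω := Set.indicator_nonneg (fun _ _ => zero_le_one) ω
      have hxy := norm_nonneg (x - y)
      nlinarith [mul_nonneg (mul_nonneg hxy (hE0 ω)) (mul_nonneg hK (add_nonneg hWX hWY)),
        mul_le_mul_of_nonneg_right hi (mul_nonneg (mul_nonneg hxy (hE0 ω)) (mul_nonneg hK (add_nonneg hWX hWY)))]
    refine (ENNReal.ofReal_le_ofReal (le_trans (le_of_eq (by ring)) hind')).trans (le_of_eq ?_)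
    have hEWX : 0 ≤ E ω * W (X ω) := mul_nonneg (hE0 ω) hWX
    have hEWY : 0 ≤ E ω * W (Y ω) := mul_nonneg (hE0 ω) hWY
    have hEVX : 0 ≤ E ω * V (X ω) := mul_nonneg (hE0 ω) hVX
    have hEVY : 0 ≤ E ω * V (Y ω) := mul_nonneg (hE0 ω) hVY
    have hML : 0 ≤ Mφ * (L + 1) := mul_nonneg hM (by linarith)
    have hMt : 0 ≤ Mφ * (L + 1) * (E ω * V (X ω) + E ω * V (Y ω)) := mul_nonneg hML (add_nonneg hEVX hEVY)
    by_cases hω' : ω ∈ S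
    · simp only [Set.indicator_of_mem hω', one_mul]
      rw [ENNReal.ofReal_mul (norm_nonneg _), ENNReal.ofReal_add (mul_nonneg hK (add_nonneg hEWX hEWY)) hMt,
        ENNReal.ofReal_mul hK, ENNReal.ofReal_add hEWX hEWY, ENNReal.ofReal_mul hML, ENNReal.ofReal_add hEVX hEVY]
    · simp only [Set.indicator_of_notMem hω', zero_mul, zero_add, mul_zero, add_zero]
      rw [ENNReal.ofReal_mul (norm_nonneg _), ENNReal.ofReal_mul hML, ENNReal.ofReal_add hEVX hEVY]
  refine (lintegral_mono hpt).trans ?_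
  -- linearity
  have hm1 : Measurable fun ω => ENNReal.ofReal (E ω * W (X ω)) := ENNReal.measurable_ofReal.comp (hEm.mul (hWm.comp hXm))
  have hm2 : Measurable fun ω => ENNReal.ofReal (E ω * W (Y ω)) := ENNReal.measurable_ofReal.comp (hEm.mul (hWm.comp hYm))
  have hm3 : Measurable fun ω => ENNReal.ofReal (E ω * V (X ω)) := ENNReal.measurable_ofReal.comp (hEm.mul (hVm.comp hXm))
  have hm4 : Measurable fun ω => ENNReal.ofReal (E ω * V (Y ω)) := ENNReal.measurable_ofReal.comp (hEm.mul (hVm.comp hYm))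
  have hm1' : Measurable fun ω => S.indicator (fun ω => ENNReal.ofReal (E ω * W (X ω))) ω := hm1.indicator hSm
  have hm2' : Measurable fun ω => S.indicator (fun ω => ENNReal.ofReal (E ω * W (Y ω))) ω := hm2.indicator hSm
  have hmW : Measurable fun ω => S.indicator (fun ω => ENNReal.ofReal (E ω * W (X ω))) ω +
      S.indicator (fun ω => ENNReal.ofReal (E ω * W (Y ω))) ω := hm1'.add hm2'
  have hmV : Measurable fun ω => ENNReal.ofReal (E ω * V (X ω)) + ENNReal.ofReal (E ω * V (Y ω)) := hm3.add hm4
  have hmW' : Measurable fun ω => ENNReal.ofReal Kφ * (S.indicator (fun ω => ENNReal.ofReal (E ω * W (X ω))) ω +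
      S.indicator (fun ω => ENNReal.ofReal (E ω * W (Y ω))) ω) := hmW.const_mul _
  have hmV' : Measurable fun ω => ENNReal.ofReal (Mφ * (L + 1)) * (ENNReal.ofReal (E ω * V (X ω)) + ENNReal.ofReal (E ω * V (Y ω))) :=
    hmV.const_mul _
  have hmAll : Measurable fun ω => ENNReal.ofReal Kφ * (S.indicator (fun ω => ENNReal.ofReal (E ω * W (X ω))) ω +
      S.indicator (fun ω => ENNReal.ofReal (E ω * W (Y ω))) ω) +
      ENNReal.ofReal (Mφ * (L + 1)) * (ENNReal.ofReal (E ω * V (X ω)) + ENNReal.ofReal (E ω * V (Y ω))) := hmW'.add hmV'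
  rw [lintegral_const_mul _ hmAll, lintegral_add_left hmW', lintegral_const_mul _ hmW, lintegral_const_mul _ hmV,
    lintegral_add_left hm1', lintegral_add_left hm3]
  -- the four terms
  have h1 : ∫⁻ ω, S.indicator (fun ω => ENNReal.ofReal (E ω * W (X ω))) ω ∂wienerPair ≤
      ENNReal.ofReal (G₄ ^ (1 / 4 : ℝ) * Real.sqrt Bx) * ENNReal.ofReal π ^ (1 / 4 : ℝ) := by
    have h := lintegral_indicator_ofReal_mul_le wienerPair hEm (hWm.comp hXm) hE0 (fun ω => (Real.exp_pos _).le)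
      (Real.exp_pos _).le hBx0 hE4 (by simp_rw [Function.comp, hW, hsq]; exact hBx) hSm
    exact h.trans (mul_le_mul_right (ENNReal.rpow_le_rpow hπ (by norm_num)) _)
  have h2 : ∫⁻ ω, S.indicator (fun ω => ENNReal.ofReal (E ω * W (Y ω))) ω ∂wienerPair ≤
      ENNReal.ofReal (G₄ ^ (1 / 4 : ℝ) * Real.sqrt By) * ENNReal.ofReal π ^ (1 / 4 : ℝ) := by
    have h := lintegral_indicator_ofReal_mul_le wienerPair hEm (hWm.comp hYm) hE0 (fun ω => (Real.exp_pos _).le)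
      (Real.exp_pos _).le hBy0 hE4 (by simp_rw [Function.comp, hW, hsq]; exact hBy) hSm
    exact h.trans (mul_le_mul_right (ENNReal.rpow_le_rpow hπ (by norm_num)) _)
  have h3 : ∫⁻ ω, ENNReal.ofReal (E ω * V (X ω)) ∂wienerPair ≤ ENNReal.ofReal (Real.sqrt G * Real.sqrt Dx) :=
    lintegral_ofReal_mul_le wienerPair hEm (hVm.comp hXm) hE0 (fun ω => (Real.exp_pos _).le) (Real.exp_pos _).le hDx0 hE2
      (by simp_rw [Function.comp, hV, hsq]; exact hDx)
  have h4 : ∫⁻ ω, ENNReal.ofReal (E ω * V (Y ω)) ∂wienerPair ≤ ENNReal.ofReal (Real.sqrt G * Real.sqrt Dy) :=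
    lintegral_ofReal_mul_le wienerPair hEm (hVm.comp hYm) hE0 (fun ω => (Real.exp_pos _).le) (Real.exp_pos _).le hDy0 hE2
      (by simp_rw [Function.comp, hV, hsq]; exact hDy)
  have hπ4 : ENNReal.ofReal π ^ (1 / 4 : ℝ) = ENNReal.ofReal (π ^ (1 / 4 : ℝ)) := ENNReal.ofReal_rpow_of_nonneg hπ0 (by norm_num)
  rw [hπ4] at h1 h2
  calc ENNReal.ofReal ‖x - y‖ * (ENNReal.ofReal Kφ * ((∫⁻ ω, S.indicator (fun ω => ENNReal.ofReal (E ω * W (X ω))) ω ∂wienerPair) +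
        ∫⁻ ω, S.indicator (fun ω => ENNReal.ofReal (E ω * W (Y ω))) ω ∂wienerPair) + ENNReal.ofReal (Mφ * (L + 1)) *
        ((∫⁻ ω, ENNReal.ofReal (E ω * V (X ω)) ∂wienerPair) + ∫⁻ ω, ENNReal.ofReal (E ω * V (Y ω)) ∂wienerPair))
      ≤ ENNReal.ofReal ‖x - y‖ * (ENNReal.ofReal Kφ * (ENNReal.ofReal (G₄ ^ (1 / 4 : ℝ) * Real.sqrt Bx) * ENNReal.ofReal (π ^ (1 / 4 : ℝ)) +
          ENNReal.ofReal (G₄ ^ (1 / 4 : ℝ) * Real.sqrt By) * ENNReal.ofReal (π ^ (1 / 4 : ℝ))) + ENNReal.ofReal (Mφ * (L + 1)) *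
          (ENNReal.ofReal (Real.sqrt G * Real.sqrt Dx) + ENNReal.ofReal (Real.sqrt G * Real.sqrt Dy))) :=
        mul_le_mul_right (add_le_add (mul_le_mul_right (add_le_add h1 h2) _) (mul_le_mul_right (add_le_add h3 h4) _)) _
    _ = _ := by
        have hs : ∀ u v : ℝ, 0 ≤ Real.sqrt u * Real.sqrt v := fun u v => mul_nonneg (Real.sqrt_nonneg _) (Real.sqrt_nonneg _)
        have hg4 : 0 ≤ G₄ ^ (1 / 4 : ℝ) := Real.rpow_nonneg (Real.exp_pos _).le _
        have hπ' : 0 ≤ π ^ (1 / 4 : ℝ) := Real.rpow_nonneg hπ0 _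
        have hgb : ∀ u : ℝ, 0 ≤ G₄ ^ (1 / 4 : ℝ) * Real.sqrt u := fun u => mul_nonneg hg4 (Real.sqrt_nonneg _)
        rw [← ENNReal.ofReal_mul (hgb _), ← ENNReal.ofReal_mul (hgb _),
          ← ENNReal.ofReal_add (mul_nonneg (hgb _) hπ') (mul_nonneg (hgb _) hπ'), ← ENNReal.ofReal_add (hs _ _) (hs _ _),
          ← ENNReal.ofReal_mul hK, ← ENNReal.ofReal_mul (mul_nonneg hM (by linarith)),
          ← ENNReal.ofReal_add (mul_nonneg hK (add_nonneg (mul_nonneg (hgb _) hπ') (mul_nonneg (hgb _) hπ')))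
            (mul_nonneg (mul_nonneg hM (by linarith)) (add_nonneg (hs _ _) (hs _ _))),
          ← ENNReal.ofReal_mul (norm_nonneg _)]
        congr 1
        rw [hLdef]
        ring

/-- **The LOW-ENERGY coupling step, raw form: the cut-off observable `φ(1 − χ_R)`.** With the unit-time coupling
bound, `0 < ϑ < θ₁ < 1/(2T)`, `R ≥ 0`, an observable `φ` (continuous, value class `ϑ`, pair constant `K` at `θ₁`):
`|P_1(φ(1−χ))(x) − P_1(φ(1−χ))(y)| ≤ ‖x−y‖ (K G₄^{1/4} e^{2θ₁γT}(e^{θ₁Hx} + e^{θ₁Hy}) π^{1/4} + M (L_R+1) √G e^{2ϑγT}(e^{ϑHx} + e^{ϑHy}))`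
with `π = e^{-θ₁R} e^{2θ₁γT} e^{θ₁Hx}` (Chebyshev, CEHR Lemma 5.6). [folklore] -/
theorem cutoff_forecast_pair_bound {C₀ : ℝ} (hC : 0 ≤ C₀) (x y : PhaseSpace N)
    (hD : ∀ ω : WienerPair, ‖(pinnedChain ω₂ lam β γ).solMap N T T 1 x (pairPath ω) -
        (pinnedChain ω₂ lam β γ).solMap N T T 1 y (pairPath ω)‖ ≤
      ‖x - y‖ * Real.exp (∫ s in (0 : ℝ)..1, C₀ * (1 +
        Real.sqrt ((pinnedChain ω₂ lam β γ).hamiltonian N ((pinnedChain ω₂ lam β γ).solMap N T T s x (pairPath ω))) +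
        Real.sqrt ((pinnedChain ω₂ lam β γ).hamiltonian N ((pinnedChain ω₂ lam β γ).solMap N T T s y (pairPath ω))))))
    {ϑ θ₁ : ℝ} (hϑ : 0 < ϑ) (hϑθ : ϑ < θ₁) (hθT : θ₁ < 1 / (2 * T)) {R : ℝ} (hR : 0 ≤ R)
    {φ : PhaseSpace N → ℝ} (hφ : Continuous φ) {Mφ Kφ : ℝ} (hM : 0 ≤ Mφ) (hK : 0 ≤ Kφ)
    (hval : ∀ z, |φ z| ≤ Mφ * Real.exp (ϑ * (pinnedChain ω₂ lam β γ).hamiltonian N z))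
    (hpair : ∀ z z', ‖z - z'‖ ≤ 1 → |φ z - φ z'| ≤ Kφ * ‖z - z'‖ *
      (Real.exp (θ₁ * (pinnedChain ω₂ lam β γ).hamiltonian N z) + Real.exp (θ₁ * (pinnedChain ω₂ lam β γ).hamiltonian N z'))) :
    |(∫ z, φ z * (1 - max 0 (min 1 (R + 1 - (pinnedChain ω₂ lam β γ).hamiltonian N z)))
          ∂((pinnedChain ω₂ lam β γ).transitionKernel N T T 1 x)) -
        ∫ z, φ z * (1 - max 0 (min 1 (R + 1 - (pinnedChain ω₂ lam β γ).hamiltonian N z)))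
          ∂((pinnedChain ω₂ lam β γ).transitionKernel N T T 1 y)| ≤
      ‖x - y‖ * (Kφ * (Real.exp (4 * C₀ + (32 * C₀ ^ 2 * T + γ) +
          (16 * C₀ ^ 2 * T + 1 / (4 * T)) * (Real.sqrt ((pinnedChain ω₂ lam β γ).hamiltonian N x) +
            Real.sqrt ((pinnedChain ω₂ lam β γ).hamiltonian N y))) ^ (1 / 4 : ℝ) *
          (Real.exp (2 * θ₁ * γ * T) * (Real.exp (θ₁ * (pinnedChain ω₂ lam β γ).hamiltonian N x) +
            Real.exp (θ₁ * (pinnedChain ω₂ lam β γ).hamiltonian N y))) *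
          (Real.exp (-(θ₁ * R)) * (Real.exp (θ₁ * γ * (T + T) * (1 : ℝ≥0)) *
            Real.exp (θ₁ * (pinnedChain ω₂ lam β γ).hamiltonian N x))) ^ (1 / 4 : ℝ)) +
        Mφ * (((N * (ω₂ / 2 + 3 + lam / ω₂ + N ^ 2 * (3 + β)) + N / 2 + 1) *
          Real.exp (N * (ω₂ / 2 + 3 + lam / ω₂ + N ^ 2 * (3 + β)) + N / 2 + 1) * (R + 2) + 1) *
          Real.sqrt (Real.exp (2 * C₀ + (8 * C₀ ^ 2 * T + γ) +
            (4 * C₀ ^ 2 * T + 1 / (4 * T)) * (Real.sqrt ((pinnedChain ω₂ lam β γ).hamiltonian N x) +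
              Real.sqrt ((pinnedChain ω₂ lam β γ).hamiltonian N y)))) *
          (Real.exp (2 * ϑ * γ * T) * (Real.exp (ϑ * (pinnedChain ω₂ lam β γ).hamiltonian N x) +
            Real.exp (ϑ * (pinnedChain ω₂ lam β γ).hamiltonian N y))))) := by
  set P := pinnedChain ω₂ lam β γ with hP
  set H := P.hamiltonian N with hH
  have hHc : Continuous H := pinnedChain_continuous_hamiltonian ω₂ lam β γ N
  have hθ0 : 0 < θ₁ := hϑ.trans hϑθ
  have hθT' : θ₁ < 1 / max T T := by
    rw [max_self]; exact hθT.trans (by rw [div_lt_div_iff₀ (by positivity) hT]; linarith)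
  have hϑT : ϑ < 1 / T := by rw [← max_self T]; exact hϑθ.trans hθT'
  have h2ϑ : 0 < 2 * ϑ := by positivity
  have h2θ : 0 < 2 * θ₁ := by positivity
  have h2θ' : 2 * θ₁ < 1 / max T T := by
    rw [max_self, lt_div_iff₀ hT]; rw [lt_div_iff₀ (by positivity)] at hθT; linarith
  have h2ϑ' : 2 * ϑ < 1 / max T T := lt_trans (by linarith) h2θ'
  -- the cut-off observable
  set χ : PhaseSpace N → ℝ := fun z => max 0 (min 1 (R + 1 - H z)) with hχ
  have hχc : Continuous χ := continuous_const.max (continuous_const.min (continuous_const.sub hHc))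
  have hχ0 : ∀ z, 0 ≤ χ z := fun z => le_max_left _ _
  have hχ1 : ∀ z, χ z ≤ 1 := fun z => max_le zero_le_one (min_le_left _ _)
  set φ₂ : PhaseSpace N → ℝ := fun z => φ z * (1 - χ z) with hφ₂
  have hφ₂c : Continuous φ₂ := hφ.mul (continuous_const.sub hχc)
  have hval₂ : ∀ z, |φ₂ z| ≤ Mφ * Real.exp (ϑ * H z) := fun z => by
    simp only [hφ₂]
    rw [abs_mul, abs_of_nonneg (sub_nonneg.2 (hχ1 z))]
    calc |φ z| * (1 - χ z) ≤ |φ z| * 1 := by gcongr; linarith [hχ0 z]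
      _ ≤ _ := by rw [mul_one]; exact hval z
  have hfin := abs_forecast_sub_le_lintegral hω hl hβ hγ hN hT hφ₂c hϑ hϑT hval₂ 1 x y
  refine hfin.trans ?_
  -- moments and the event
  have hmom : ∀ (c : ℝ) (hc : 0 < c) (hc' : c < 1 / max T T) (z : PhaseSpace N),
      ∫⁻ ω, ENNReal.ofReal (Real.exp (c * H (P.solMap N T T 1 z (pairPath ω)))) ∂wienerPair ≤
      ENNReal.ofReal (Real.exp (c * γ * (T + T) * (1 : ℝ≥0)) * Real.exp (c * H z)) := fun c hc hc' z =>
    pinnedChain_lintegral_exp_hamiltonian_solMap_le hω hl hβ hγ hN hT hT hc hc' 1 z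
  have hπ := pinnedChain_measure_lt_hamiltonian_solMap_le hω hl hβ hγ hN hT hT hθ0 hθT' 1 x R
  have hcut := lintegral_abs_sub_cutoff_le hω hl hβ hγ hN hT hC x y hD (φ := φ) (ϑ := ϑ) (θ₁ := θ₁) hM hK hR hval hpair
    (by positivity) (by positivity) (by positivity) (by positivity) (by positivity)
    (hmom _ h2θ h2θ' x) (hmom _ h2θ h2θ' y) (hmom _ h2ϑ h2ϑ' x) (hmom _ h2ϑ h2ϑ' y) hπ
  have hR0 : 0 ≤ ‖x - y‖ * (Kφ * (Real.exp (4 * C₀ + (32 * C₀ ^ 2 * T + γ) +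
      (16 * C₀ ^ 2 * T + 1 / (4 * T)) * (Real.sqrt (H x) + Real.sqrt (H y))) ^ (1 / 4 : ℝ) *
      (Real.sqrt (Real.exp (2 * θ₁ * γ * (T + T) * (1 : ℝ≥0)) * Real.exp (2 * θ₁ * H x)) +
        Real.sqrt (Real.exp (2 * θ₁ * γ * (T + T) * (1 : ℝ≥0)) * Real.exp (2 * θ₁ * H y))) *
      (Real.exp (-(θ₁ * R)) * (Real.exp (θ₁ * γ * (T + T) * (1 : ℝ≥0)) * Real.exp (θ₁ * H x))) ^ (1 / 4 : ℝ)) +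
      Mφ * (((N * (ω₂ / 2 + 3 + lam / ω₂ + N ^ 2 * (3 + β)) + N / 2 + 1) *
        Real.exp (N * (ω₂ / 2 + 3 + lam / ω₂ + N ^ 2 * (3 + β)) + N / 2 + 1) * (R + 2) + 1) *
        Real.sqrt (Real.exp (2 * C₀ + (8 * C₀ ^ 2 * T + γ) + (4 * C₀ ^ 2 * T + 1 / (4 * T)) *
          (Real.sqrt (H x) + Real.sqrt (H y)))) *
        (Real.sqrt (Real.exp (2 * ϑ * γ * (T + T) * (1 : ℝ≥0)) * Real.exp (2 * ϑ * H x)) +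
          Real.sqrt (Real.exp (2 * ϑ * γ * (T + T) * (1 : ℝ≥0)) * Real.exp (2 * ϑ * H y))))) := by
    have : 0 ≤ lam / ω₂ := div_nonneg hl hω.le
    positivity
  refine ((ENNReal.toReal_mono ENNReal.ofReal_ne_top hcut).trans_eq (ENNReal.toReal_ofReal hR0)).trans (le_of_eq ?_)
  -- evaluate the square roots: `√(e^{2cγ(T+T)} e^{2cH}) = e^{2cγT} e^{cH}`
  have hsqD : ∀ (c : ℝ) (z : PhaseSpace N), Real.sqrt (Real.exp (2 * c * γ * (T + T) * (1 : ℝ≥0)) * Real.exp (2 * c * H z)) =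
      Real.exp (2 * c * γ * T) * Real.exp (c * H z) := fun c z => by
    rw [← Real.exp_add, ← Real.exp_add, Real.sqrt_eq_iff_mul_self_eq_of_pos (Real.exp_pos _), ← Real.exp_add]
    congr 1; push_cast; ring
  rw [hsqD θ₁ x, hsqD θ₁ y, hsqD ϑ x, hsqD ϑ y]
  ring

end Flow

/-- **Registered form of this file's pointwise inequality** (`stub_lasotaYorke_aux5`, closed statement of
`cutoff_pointwise`). [folklore] -/
theorem stub_lasotaYorke_aux5 :
    ∀ (a b cX cY wX wY vX vY D d K M L : ℝ), 0 ≤ K → 0 ≤ M → 0 ≤ L → 0 ≤ wX → 0 ≤ wY → 0 ≤ vX → 0 ≤ vY →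
      0 ≤ D → D ≤ d → 0 ≤ cX → cX ≤ 1 → 0 ≤ cY → cY ≤ 1 →
      (D ≤ 1 → |a - b| ≤ K * D * (wX + wY)) → (D ≤ 1 → |cX - cY| ≤ L * D) → |a| ≤ M * vX → |b| ≤ M * vY →
      |a * (1 - cX) - b * (1 - cY)| ≤ d * ((1 - cX) * (K * (wX + wY)) + M * (L + 1) * (vX + vY)) :=
  cutoff_pointwise

end Summit.AtomisticToContinuum.FouriersLaw.Cruxes.StaticKubo.Birth.Stubs

end
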